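import Literature.MathematicalPhysics.QuantumFieldTheory.Balaban1983to89.Node00.Record12BgRowCoClassCPMFloorB
import Literature.MathematicalPhysics.QuantumFieldTheory.Balaban1983to89.B11Thm1ExistsUniqueInductionG

/-!
# `Balaban1983to89.B11Thm1ExistsUniqueTokensGB` — [Balaban1985Variational] = «[15]», Theorem 1 p. 279 (existence ∕ uniqueness half) and its producer shape (11)–(14), Prop. 2:
# THE LANE's (E∕U) NAMED FACT, ITS STEP ∕ SUPPLY ∕ LIFT TOKENS AND (14), OVER A **BOND-LEVEL DETERMINING DATUM** `bd : Node00.BondDatum F` AND A **TOP-DATA PREDICATE**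
# `Dat : Node00.TopData F N` — `VariationalThm1EUSep{Top,CoP}7MGB`, `VariationalThm1EUStep{Top,CoP}7MGB`, `ApproxMinimiserExists{Top,CoP}7MGB`, `VariationalThm1EULift{Top,CoP}7MGB`,
# `ApproxMinTopB` — parametrised EXACTLY as K0's S1a-C module `Node00/Record12BgRowCoClassCPMFloorB` parametrises the (R) half `Node00.VariationalThm1RegSep{Top,CoP}7MGB`; the
# (b)-instances `B11Thm1ExistsUniqueCoP7MG` (✓ #10741) ∕ `B11Thm1ExistsUniqueStepTokensG` ∕ `B11Thm1ExistsUniqueInductionG` ARE the instance `(Node00.genSetDatum F, Node00.dataSmall7PTopOf F N)` by `Iff.rfl`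

Honest framing: statement-level skeleton of published theorems with citation tags; proofs where landed; nothing here is a claim about the Yang–Mills mass gap.  Cell `pub-ymgap`
(HUMAN RULINGS D-0062 ∕ D-0149), lane `pub-ymgap-dag-n12-c` g34 (R134 seat (a), N12 = [B15], s1 — the CONSUMER lane of the (E∕U) fact); `--kind definition --supports` K1⁹
`stmt-QuantumFields-27364`; count-neutral; N12 NOT discharged; finite 𝕋⁴ at fixed ε; nothing continuum ∕ ℝ⁴ ∕ OS ∕ mass-gap ∕ Clay.  Named `Prop`s WITH PARAMETERS, NEVER ASSERTED
(no `sorry`, no `axiom`, no `instance`, no `notation`); THIS FILE IS STATEMENT-ONLY (definitions + `Iff.rfl`); the proved bridges ∕ reductions ∕ induction over `(bd, Dat)` live in the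
sibling THEOREMS-ONLY module `B11Thm1ExistsUniqueTokensGBBridges`.

HONESTY GUARD (director-ym №338 (5), verbatim shape).  PURELY ADDITIVE: print-datum parametrisation of `B11Thm1ExistsUniqueCoP7MG` §1, `B11Thm1ExistsUniqueStepTokensG` §1–§3 and
`B11Thm1ExistsUniqueInductionG` §2 (FLAG №16 ∕ LOCATE-HSEAM 5d3298b8d191f169; (E1) variant (iii-b)); the (b)-instances `VariationalThm1EUSepTop7MG ∕ …CoP7MG`, `ApproxMinTop`,
`VariationalThm1EUStepTop7MG ∕ …CoP7MG`, `ApproxMinimiserExistsTop7MG ∕ …CoP7MG`, `VariationalThm1EULiftTop7MG ∕ …CoP7MG` stay landed and true on their own text (the `…_iff_GB` ∕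
`approxMinTop_iff_B` below are `Iff.rfl`); NOTHING in those modules is edited; no displayed premise of any sentence is deleted or weakened — the data row `Sect2.DataSmall7PTop …`, the
minimiser's datum `genSet s.Ω k` (through `IsMinimizer` = `IsMinimizerB … (bondsDet ·)`, F0a `isMinimizer_iff_isMinimizerB`), the agreement half of (14) (`AgreeOn` = `AgreeOnB (bondsDet ·)`,
F0a `agreeOn_iff_agreeOnB`) and the bond class of the tower-central uniqueness row (`bondsOf (genSet s.Ω k n)` = `bondsDet (genSet s.Ω k) n`) become the PARAMETERS `(Dat, bd)`, and the
old sentences are one instance.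

WHY (Stage 2 of the (iii-b) programme, director-ym №343; dag-n12-d's N12 blast census I.32897 (3)(ii) «EU∕STEP∕SUPPLY∕LIFT ᴮ = n12-c»).  N12's junction of record «12Q-DIRECT v14ᴸ»
(#10983, `Summits/…/BalabanUVNodesN12AtRecord13Prop1KnitThm1WindowDirectDatumScaleLettersDischargedAtLengthOfThm1NamedFactsGOfRecord`) displays exactly two [15] names:
`h15 : Node00.VariationalThm1RegSepCoP7MG F 2 Adm B₃ a₀ a₁` ((8), K0's) and `h15EU : B11Thm1ExistsUniqueCoP7MG.VariationalThm1EUSepCoP7MG F 2 Adm B₃ a₀ a₁` ((E∕U), the lane's).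
Both read [III] (2.12) on the READING-(b) fibre — the minimiser constrained on every bond MEETING `Γ_j` ([I] p. 251 «bonds which intersect Γ_j»).  Print's Theorem 1 is about the
minimiser on the [II] (2.3) fibre *«Λ_j = Ω_j^{(j)} ∖ Ω_{j+1}^{(j)} … (2.3) for the sets of sites and the sets of bonds»* (p. 224; the DIFFERENCE of the bond sets — an inward connector
belongs to no `Λ_j`: ruling (α) of record, director-ym №339), and today's Stage 2 re-points the record's background `Node00.UbgOfRecord₁₃CoP (n+1)` to that fibre
(`Node00.UbgMSCoPOfRecordB`, F0a's `lamBondsSeq`).  K0's S1a-C (`Node00/Record12BgRowCoClassCPMFloorB`, k0-s1-w1 g9) typed the (R) name over `(bd, Dat)`; THIS FILE types the (E∕U)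
name and its three producer tokens over the same `(bd, Dat)`, so that the junction's re-key (dag-n12-d) and any (E∕U) producer item can be stated at print's datum
`(Node00.lamDatum F, Node00.dataSmall7LamTopOf F N)` — or at any other — by instantiation, with the (b)-road recovered definitionally.

A GAIN IN FIDELITY AT PRINT's DATUM (the lane's LOCATED note (ℓ2) of `B11Thm1ExistsUniqueStepTokensG`, now a parameter choice).  In the `bondsOf`-MEETING convention a scale-`j` bond
sticking INTO `Ω_{j+1}` is constrained, so the (E) clause, the supply token and the lift (11)–(13) carry a small-data INTERFACE-SOLVABILITY statement print never meets; at `bd :=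
Node00.lamDatum F` (inward connectors dropped, ruling (α)) that artefact is ABSENT — print's (3) «U_j = V on Λ_j» verbatim.  The tower-central uniqueness row is read on the SAME bond class
`bd K k s.Ω n` as the constraint (print's orbit group (4) «u(y) = 1 for y ∈ 𝔅_k», read modulo the centre, acts exactly at the constrained bonds).

CONTENTS (every `def` a `Prop` with parameters, NEVER asserted; every theorem `Iff.rfl`).
* §1 `ApproxMinTopB av Ω Ω₀ k ρ 𝔅 W U₀` — [15] (14) with the agreement half on a bond-level datum `𝔅 : BDetSet P` (`AgreeOnB 𝔅 (avgFamily av U₀) W`); `approxMinTop_iff_B` (the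
  (b)-instance `ApproxMinTop … W U₀` IS `ApproxMinTopB … (bondsDet (genSet Ω k)) W U₀`, `Iff.rfl`).
* §2 ★ `VariationalThm1EUSepTop7MGB F N Sup Adm bd Dat B₃ a₀ a₁` ∕ `…CoP7MGB` — ✓ #10741's bodies with the data row `Dat K s.Ω (Sup ν K s.Ω) k δ W`, the minimiser rows
  `IsMinimizerB (avOfRecord F N K) {class (6)} (bd K k s.Ω) W ·` and the tower-central row `∀ b ∈ bd K k s.Ω n`; `variationalThm1EUSepTop7MG_iff_GB ∕ …CoP7MG_iff_GB` (`Iff.rfl` at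
  `(genSetDatum F, dataSmall7PTopOf F N)`), `variationalThm1EUSepCoP7MGB_iff` (CoP = Top at `suppDomOfRecord`, `Iff.rfl`).
* §3 ★ `VariationalThm1EUStepTop7MGB ∕ …CoP7MGB F N [Sup] Adm bd Dat C₁ B₃ a₀ a₁` ([15] Prop. 2 + Sects. B–E given an approximate minimiser (14) at `C₁B₃δ`) and
  `ApproxMinimiserExistsTop7MGB ∕ …CoP7MGB` ((11)–(13): an approximate minimiser exists) over `(bd, Dat)`; `…_iff_GB` ×2 and `…_iff` ×2 (`Iff.rfl`).
* §4 ★ `VariationalThm1EULiftTop7MGB ∕ …CoP7MGB F N [Sup] Adm bd Dat C₁ B₃ a₀ a₁` — print's lift (11)–(13) along the truncation `truncSeq s` (`B11Thm1ExistsUniqueInductionG` §1) over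
  `(bd, Dat)`: truncated datum `bd K k (truncSeq s).Ω`, truncated data row `Dat K (truncSeq s).Ω (Sup ν K (truncSeq s).Ω) k δ′ V₀`; `…_iff_GB`, `…_iff` (`Iff.rfl`).
NOT HERE (sibling `…TokensGBBridges`, THEOREMS ONLY): `.toTop ∕ .toCoP`, `.of_le ∕ .of_imp ∕ .of_imp_dat ∕ .and_left ∕ .and_right ∕ .of_C₁_le` for the four tokens; the (14) accessors;
★★ NAME ⇐ STEP ∧ SUPPLY; ★ SUPPLY ⇐ NAME ∧ K0's `Node00.VariationalThm1RegSepTop7MGB` (S1a-C); ★★★ print's k-induction NAME ⇐ STEP ∧ (R) ∧ SUPPLY-at-length-1 ∧ LIFT ∧ guard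
truncation-stability, over `(bd, Dat)` (proof = `B11Thm1ExistsUniqueInductionGBridges`' verbatim).  Also NOT here: the (7) predicate of the print datum (def-Y's §7′
`Node00/Record12BgRowMixedDataB`, plugged as `Dat := Node00.dataSmall7LamTopOf F N` by the consumer — dag-n07-e's `Node00/CriticalOnFibreTopGuardedBPrint`); any producer; any A2 ∕
non-vacuity certificate at print's datum (the lane's flat-datum certificates ✓p744645 ∕ ✓p759453 are at the (b)-instance and import the red-by-closure `N12AtRecord13*` road — their
print-datum twins are pre-staged only, per the red-window notice).

HONEST SCOPE.  Definitions of named facts + `Iff.rfl` bookkeeping; nothing of [15]'s analysis asserted or proved; no (b)-instance fact is claimed false (FLAG №16 concerns which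
instance print PROVES); `stub_prop8StepCoPGridG13` ∕ K0⁷ NOT closed; K1⁹ OPEN; N12 NOT discharged; counts unmoved (discharged 8∕27); one finite 𝕋⁴ programme at fixed ε — the route
closes the conditional finite-𝕋⁴ rung `BalabanLadder.UV` only; nothing continuum ∕ ℝ⁴ ∕ OS; the Yang–Mills mass gap (Clay) is NOT proved by any of this.

References: [15] = [Balaban1985Variational] (1) p.277, (2)–(7) p.278, Thm 1 (8) p.279, (11) p.279, (12)–(14) p.280, (15)–(21) pp.280–281, Prop. 2 p.281, (141)–(142) p.299;
[6] = [Balaban1985RegularSpaces] (1.3)–(1.9) p.77; [II] = [Balaban1984PropagatorsII] (2.3) p.224; [III] = [Balaban1988Convergent] (2.1) p.254, (2.2) p.255, (2.10)–(2.12) p.256,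
(2.18) p.257; [I] = [Balaban1987RG1] (0.1) p.251.
-/

noncomputable section

namespace Literature.MathematicalPhysics.QuantumFieldTheory.Balaban1983to89.B11Thm1ExistsUniqueTokensGB

open T4Continuum B15DeterminingSets B15DeterminingSetsB GaugeField Node00
open B16Sect1Backgrounds (toMS)
open B11Thm1ExistsUniqueCoP7MG (VariationalThm1EUSepTop7MG VariationalThm1EUSepCoP7MG)
open B11Thm1ExistsUniqueStepTokensG (ApproxMinTop VariationalThm1EUStepTop7MG VariationalThm1EUStepCoP7MG ApproxMinimiserExistsTop7MG ApproxMinimiserExistsCoP7MG)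
open B11Thm1ExistsUniqueInductionG (truncSeq VariationalThm1EULiftTop7MG VariationalThm1EULiftCoP7MG)

/-! ## §1  [15] (14) with the agreement half on a bond-level datum -/

section Approx

variable {P : Params} {N : ℕ} [NeZero N]

/-- **[15] (14) p. 280 OVER A BOND-LEVEL DETERMINING DATUM `𝔅`** — `B11Thm1ExistsUniqueStepTokensG.ApproxMinTop` with the agreement half `AgreeOnB 𝔅 (avgFamily av U₀) W` ([III]
(2.10) over `𝔅`, F0a) in place of `AgreeOn (genSet Ω k) …`; the two regularity clauses (the SHAPE of (8)'s conclusion on the class ranges of the top domain `Ω₀`) are unchanged.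
*«U₀ ∈ U_k({Ω_j}, C₁B₃ε₁), |U₀ − V| < C₁ε₁ on Λ_j, j = 0, 1, …, k»* read at distance zero on the bonds of `𝔅`.  Print-datum parametrisation of `ApproxMinTop` (FLAG №16 ∕
LOCATE-HSEAM 5d3298b8d191f169); the (b)-instance `ApproxMinTop` stays landed and true on its own text (`approxMinTop_iff_B`).
-- TODO(general form): print allows `|U₀ − V| < C₁ε₁` on `Λ_j`; exact agreement is the special case Theorem 1's own proof uses ((13), and `U₀ = V₀` at `k = 1`).
[cite: Balaban1985Variational, (14) p.280, (2)–(3) p.278; Balaban1985RegularSpaces, (1.3)–(1.9) p.77; Balaban1988Convergent, (2.10)–(2.11) p.256; Balaban1984PropagatorsII, (2.3) p.224] -/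
def ApproxMinTopB (av : ∀ j, Averaging P j (SU N)) (Ω : ℕ → Set (Site P 0)) (Ω₀ : Set (Site P 0)) (k : ℕ) (ρ : ℕ → ℝ) (𝔅 : BDetSet P) (W : MSField P (SU N))
    (U₀ : GaugeField P 0 (SU N)) : Prop :=
  (∀ n, n ≤ k → PlaqSmallOn (Sect2.omegaPlaqsTop Ω Ω₀ n) (ρ n * P.eta n ^ 2) U₀) ∧
    (∀ n, n ≤ k → Sect2.CoDivSmallOn (Sect2.omegaBondsTop Ω Ω₀ n) (ρ n * P.eta n ^ 3) U₀) ∧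
      AgreeOnB 𝔅 (avgFamily av U₀) W

/-- The (b)-instance: `ApproxMinTop av Ω Ω₀ k ρ W U₀` IS `ApproxMinTopB av Ω Ω₀ k ρ (bondsDet (genSet Ω k)) W U₀` — definitionally (F0a `agreeOn_iff_agreeOnB`).
[cite: Balaban1985Variational, (14) p.280; Balaban1988Convergent, (2.10) p.256; Balaban1987RG1, (0.1) p.251] -/
theorem approxMinTop_iff_B (av : ∀ j, Averaging P j (SU N)) (Ω : ℕ → Set (Site P 0)) (Ω₀ : Set (Site P 0)) (k : ℕ) (ρ : ℕ → ℝ) (W : MSField P (SU N))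
    (U₀ : GaugeField P 0 (SU N)) : ApproxMinTop av Ω Ω₀ k ρ W U₀ ↔ ApproxMinTopB av Ω Ω₀ k ρ (bondsDet (genSet Ω k)) W U₀ := Iff.rfl

end Approx

/-! ## §2  The (E∕U) named fact over `(bd, Dat)` -/

section NamedFactGB

variable (F : T4Family) (N : ℕ) [NeZero N]

/-- **★ NAMED FACT — [15] THEOREM 1, EXISTENCE OF THE MINIMAL ORBIT AND ITS UNIQUENESS (MODULO TOWER-CENTRAL GAUGES), GUARD-GENERIC, OVER A BOND DATUM `bd` AND A TOP-DATA
PREDICATE `Dat`** (a `Prop` with parameters, NEVER asserted): `B11Thm1ExistsUniqueCoP7MG.VariationalThm1EUSepTop7MG` with the data row `Dat K s.Ω (Sup ν K s.Ω) k δ W`, the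
minimiser rows `IsMinimizerB (avOfRecord F N K) {class (6) at ε₀} (bd K k s.Ω) W ·` ([III] (2.12) over the bond datum, F0a) and the uniqueness row's bond class `bd K k s.Ω n`; every
other byte identical (numerics `ν`, cube letter `M`, couplings `g`, torus `K`, length `0 < k`, separated (2.18) index `s` of record, `0 < ν.M₁`, guard `Adm`, thresholds `0 < δ_n ≤
a₁`, `B₃δ_n ≤ ε₀ ≤ a₀` comparable both ways).  Conclusion: a minimiser of (5) over the class (6) at `ε₀` with the data `W` on `bd K k s.Ω` EXISTS, and any two such minimisers
`U₁, U₂` satisfy `U₂ = U₁^u` for a gauge transformation `u` whose scale-`n` images at the two ends of every bond of `bd K k s.Ω n`, `n ≤ k`, are equal and central.  Verbatim p. 279: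
*«there exists a minimal orbit in the space (8). This orbit is a unique critical orbit in the space (6) if B₃ε₁ ≤ ε₀ and ε₀ ≤ a₀.»*  Print-datum parametrisation of
`VariationalThm1EUSepTop7MG` (FLAG №16 ∕ LOCATE-HSEAM 5d3298b8d191f169); the (b)-instance stays landed and true on its own text (`variationalThm1EUSepTop7MG_iff_GB`); print's road
is the instance `(lamDatum F, dataSmall7LamTopOf F N)`.
-- TODO(general form): print's orbit group (4) «u(y) = 1 for y ∈ 𝔅_k» read modulo the centre (datum-preserving gauges); general admissible `{Ω_j}`; one threshold `ε₁`.
[cite: Balaban1985Variational, Thm 1 p.279, (1) p.277, (2)–(7) p.278; Balaban1985RegularSpaces, (1.3)–(1.9) p.77; Balaban1984PropagatorsII, (2.3) p.224; Balaban1988Convergent, p.255, (2.10)–(2.12) p.256, (2.18) p.257; Balaban1987RG1, (0.1) p.251] -/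
def VariationalThm1EUSepTop7MGB (Sup : (ν : Stage7Numerics) → (K : ℕ) → (ℕ → Set (Site (F.P K) 0)) → Set (Site (F.P K) 0)) (Adm : StepGuard F) (bd : BondDatum F)
    (Dat : TopData F N) (B₃ a₀ a₁ : ℝ) : Prop :=
  ∀ (ν : Stage7Numerics) (M : ℕ) (g : ℕ → ℝ) (K k : ℕ) (s : SeqOfRecord F ν M g K k), 0 < k → Sect2.SeqSeparated ν.M₁ s → 0 < ν.M₁ → Adm ν M g K k s → ∀ (ε₀ : ℝ) (δ : ℕ → ℝ),
    (∀ n, n ≤ k → 0 < δ n ∧ δ n ≤ a₁ ∧ B₃ * δ n ≤ ε₀) → (∀ n, n < k → δ n ≤ 2 * δ (n + 1)) → (∀ n, n < k → δ (n + 1) ≤ 2 * δ n) → ε₀ ≤ a₀ →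
    ∀ W : MSField (F.P K) (SU N), Dat K s.Ω (Sup ν K s.Ω) k δ W →
      (∃ U₀ : GaugeField (F.P K) 0 (SU N), IsMinimizerB (avOfRecord F N K)
          {U | (∀ n, n ≤ k → PlaqSmallOn (Sect2.omegaPlaqsTop s.Ω (Sup ν K s.Ω) n) (ε₀ * (F.P K).eta n ^ 2) U) ∧
            Sect2.CoDivClassOnTop s.Ω (Sup ν K s.Ω) k ε₀ U} (bd K k s.Ω) W U₀) ∧
      ∀ U₁ U₂ : GaugeField (F.P K) 0 (SU N),
        IsMinimizerB (avOfRecord F N K)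
            {U | (∀ n, n ≤ k → PlaqSmallOn (Sect2.omegaPlaqsTop s.Ω (Sup ν K s.Ω) n) (ε₀ * (F.P K).eta n ^ 2) U) ∧
              Sect2.CoDivClassOnTop s.Ω (Sup ν K s.Ω) k ε₀ U} (bd K k s.Ω) W U₁ →
        IsMinimizerB (avOfRecord F N K)
            {U | (∀ n, n ≤ k → PlaqSmallOn (Sect2.omegaPlaqsTop s.Ω (Sup ν K s.Ω) n) (ε₀ * (F.P K).eta n ^ 2) U) ∧
              Sect2.CoDivClassOnTop s.Ω (Sup ν K s.Ω) k ε₀ U} (bd K k s.Ω) W U₂ →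
        ∃ u : GaugeTransf (F.P K) 0 (SU N),
          (∀ n, n ≤ k → ∀ b ∈ bd K k s.Ω n, toMS u n b.src = toMS u n b.tgt ∧ ∀ g : SU N, toMS u n b.src * g = g * toMS u n b.src) ∧
            gaugeAct u U₁ = U₂

/-- **★★ NAMED FACT, `CoP` EDITION OVER `(bd, Dat)` — [15] THEOREM 1 (EXISTENCE ∕ UNIQUENESS) ON THE SUPPORT OF RECORD `suppDomOfRecord`**: §2's sentence at node00-def-R's selector
— the print-datum parametrisation of the name `VariationalThm1EUSepCoP7MG` N12's junction of record reads (`variationalThm1EUSepCoP7MG_iff_GB`).  A `Prop` with parameters, NEVER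
asserted; NO producer in the tree.
-- TODO(general form): as above.
[cite: Balaban1985Variational, Thm 1 p.279, (2)–(7) p.278; Balaban1984PropagatorsII, (2.3) p.224; Balaban1988Convergent, p.255, (2.12) p.256] -/
def VariationalThm1EUSepCoP7MGB (Adm : StepGuard F) (bd : BondDatum F) (Dat : TopData F N) (B₃ a₀ a₁ : ℝ) : Prop :=
  VariationalThm1EUSepTop7MGB F N (fun ν K Ω => suppDomOfRecord F ν K Ω) Adm bd Dat B₃ a₀ a₁

variable {F N}

/-- ★ The lane's `VariationalThm1EUSepTop7MG` (✓ #10741's top-domain name) IS the instance `(genSetDatum F) (dataSmall7PTopOf F N)` — definitionally (`IsMinimizer … 𝔹 = IsMinimizerB …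
(bondsDet 𝔹)`, `bondsOf (genSet s.Ω k n) = bondsDet (genSet s.Ω k) n`). [cite: Balaban1985Variational, Thm 1 p.279; Balaban1988Convergent, (2.10)–(2.12) p.256; Balaban1987RG1, (0.1) p.251] -/
theorem variationalThm1EUSepTop7MG_iff_GB {Sup : (ν : Stage7Numerics) → (K : ℕ) → (ℕ → Set (Site (F.P K) 0)) → Set (Site (F.P K) 0)} {Adm : StepGuard F} {B₃ a₀ a₁ : ℝ} :
    VariationalThm1EUSepTop7MG F N Sup Adm B₃ a₀ a₁ ↔ VariationalThm1EUSepTop7MGB F N Sup Adm (genSetDatum F) (dataSmall7PTopOf F N) B₃ a₀ a₁ := Iff.rfl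

/-- ★ The name of record `VariationalThm1EUSepCoP7MG` (#10741) IS the instance `(genSetDatum F) (dataSmall7PTopOf F N)`, definitionally. [cite: Balaban1985Variational, Thm 1 p.279; Balaban1988Convergent, (2.12) p.256] -/
theorem variationalThm1EUSepCoP7MG_iff_GB {Adm : StepGuard F} {B₃ a₀ a₁ : ℝ} :
    VariationalThm1EUSepCoP7MG F N Adm B₃ a₀ a₁ ↔ VariationalThm1EUSepCoP7MGB F N Adm (genSetDatum F) (dataSmall7PTopOf F N) B₃ a₀ a₁ := Iff.rfl

/-- The `CoP` edition IS the top-domain fact at node00-def-R's selector of record (definitional). [cite: Balaban1985Variational, Thm 1 p.279 (bookkeeping)] -/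
theorem variationalThm1EUSepCoP7MGB_iff {Adm : StepGuard F} {bd : BondDatum F} {Dat : TopData F N} {B₃ a₀ a₁ : ℝ} :
    VariationalThm1EUSepCoP7MGB F N Adm bd Dat B₃ a₀ a₁ ↔ VariationalThm1EUSepTop7MGB F N (fun ν K Ω => suppDomOfRecord F ν K Ω) Adm bd Dat B₃ a₀ a₁ := Iff.rfl

end NamedFactGB

/-! ## §3  The one-length step tokens and the supply tokens over `(bd, Dat)` -/

section TokensGB

variable (F : T4Family) (N : ℕ) [NeZero N]

/-- **★ NAMED TOKEN — [15] THEOREM 1 (E∕U) AT ONE LENGTH, GIVEN AN APPROXIMATE MINIMISER WITH (14), OVER `(bd, Dat)`** (a `Prop` with parameters, NEVER asserted):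
`B11Thm1ExistsUniqueStepTokensG.VariationalThm1EUStepTop7MG` with the data row `Dat …`, the (14) row `ApproxMinTopB … (bd K k s.Ω) W U₀`, the minimiser rows `IsMinimizerB … (bd K k
s.Ω) W ·` and the uniqueness row's bond class `bd K k s.Ω n`; every other byte identical.  [15] Prop. 2 + Sects. B–E: *«All critical orbits of the functional (5) in the space (6) …
can be obtained by taking critical configurations U₁ of the functional A(U₁U₀) in the space defined by (19)–(21), where U₀ satisfies (14)»*, *«for ε₁, ε₂ sufficiently small there
exists exactly one critical configuration, which is a minimum of the functional (5)»* (p. 281).  Print-datum parametrisation of `VariationalThm1EUStepTop7MG` (FLAG №16 ∕ LOCATE-HSEAM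
5d3298b8d191f169); the (b)-instance stays landed and true on its own text (`variationalThm1EUStepTop7MG_iff_GB`).  NO producer in the tree.
-- TODO(general form): print's (14) with `|U₀ − V| < C₁ε₁`; the orbit group (4) read modulo the centre; general admissible `{Ω_j}`; one threshold `ε₁`.
[cite: Balaban1985Variational, (14) p.280, (15)–(21) pp.280–281, Prop. 2 p.281, (141)–(142) p.299, Thm 1 p.279; Balaban1985RegularSpaces, (1.3)–(1.9) p.77; Balaban1984PropagatorsII, (2.3) p.224; Balaban1988Convergent, (2.12) p.256, (2.18) p.257] -/
def VariationalThm1EUStepTop7MGB (Sup : (ν : Stage7Numerics) → (K : ℕ) → (ℕ → Set (Site (F.P K) 0)) → Set (Site (F.P K) 0)) (Adm : StepGuard F) (bd : BondDatum F)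
    (Dat : TopData F N) (C₁ B₃ a₀ a₁ : ℝ) : Prop :=
  ∀ (ν : Stage7Numerics) (M : ℕ) (g : ℕ → ℝ) (K k : ℕ) (s : SeqOfRecord F ν M g K k), 0 < k → Sect2.SeqSeparated ν.M₁ s → 0 < ν.M₁ → Adm ν M g K k s → ∀ (ε₀ : ℝ) (δ : ℕ → ℝ),
    (∀ n, n ≤ k → 0 < δ n ∧ δ n ≤ a₁ ∧ B₃ * δ n ≤ ε₀) → (∀ n, n < k → δ n ≤ 2 * δ (n + 1)) → (∀ n, n < k → δ (n + 1) ≤ 2 * δ n) → ε₀ ≤ a₀ →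
    ∀ W : MSField (F.P K) (SU N), Dat K s.Ω (Sup ν K s.Ω) k δ W →
      ∀ U₀ : GaugeField (F.P K) 0 (SU N), ApproxMinTopB (avOfRecord F N K) s.Ω (Sup ν K s.Ω) k (fun n => C₁ * B₃ * δ n) (bd K k s.Ω) W U₀ →
      (∃ U : GaugeField (F.P K) 0 (SU N), IsMinimizerB (avOfRecord F N K)
          {U | (∀ n, n ≤ k → PlaqSmallOn (Sect2.omegaPlaqsTop s.Ω (Sup ν K s.Ω) n) (ε₀ * (F.P K).eta n ^ 2) U) ∧
            Sect2.CoDivClassOnTop s.Ω (Sup ν K s.Ω) k ε₀ U} (bd K k s.Ω) W U) ∧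
      ∀ U₁ U₂ : GaugeField (F.P K) 0 (SU N),
        IsMinimizerB (avOfRecord F N K)
            {U | (∀ n, n ≤ k → PlaqSmallOn (Sect2.omegaPlaqsTop s.Ω (Sup ν K s.Ω) n) (ε₀ * (F.P K).eta n ^ 2) U) ∧
              Sect2.CoDivClassOnTop s.Ω (Sup ν K s.Ω) k ε₀ U} (bd K k s.Ω) W U₁ →
        IsMinimizerB (avOfRecord F N K)
            {U | (∀ n, n ≤ k → PlaqSmallOn (Sect2.omegaPlaqsTop s.Ω (Sup ν K s.Ω) n) (ε₀ * (F.P K).eta n ^ 2) U) ∧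
              Sect2.CoDivClassOnTop s.Ω (Sup ν K s.Ω) k ε₀ U} (bd K k s.Ω) W U₂ →
        ∃ u : GaugeTransf (F.P K) 0 (SU N),
          (∀ n, n ≤ k → ∀ b ∈ bd K k s.Ω n, toMS u n b.src = toMS u n b.tgt ∧ ∀ g : SU N, toMS u n b.src * g = g * toMS u n b.src) ∧
            gaugeAct u U₁ = U₂

/-- **★★ NAMED TOKEN, `CoP` EDITION OVER `(bd, Dat)` — [15] THEOREM 1 (E∕U) AT ONE LENGTH GIVEN AN APPROXIMATE MINIMISER, ON THE SUPPORT OF RECORD**: §3's top-domain token at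
node00-def-R's selector — the print-datum parametrisation of `VariationalThm1EUStepCoP7MG` (`variationalThm1EUStepCoP7MG_iff_GB`); the token an (E∕U) producer item at print's
datum `(lamDatum F, dataSmall7LamTopOf F N)` would be filed against, exactly as K0's V23 stub 1 is filed against `Node00.Prop8RegSepTopStepGB`'s print instance.  NEVER asserted; NO
producer in the tree.
-- TODO(general form): as above.
[cite: Balaban1985Variational, (14) p.280, Prop. 2 p.281, (141)–(142) p.299; Balaban1984PropagatorsII, (2.3) p.224; Balaban1988Convergent, p.255, (2.12) p.256] -/
def VariationalThm1EUStepCoP7MGB (Adm : StepGuard F) (bd : BondDatum F) (Dat : TopData F N) (C₁ B₃ a₀ a₁ : ℝ) : Prop :=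
  VariationalThm1EUStepTop7MGB F N (fun ν K Ω => suppDomOfRecord F ν K Ω) Adm bd Dat C₁ B₃ a₀ a₁

/-- **NAMED TOKEN — AN APPROXIMATE MINIMISER WITH (14) EXISTS, OVER `(bd, Dat)`** (a `Prop` with parameters, NEVER asserted): `B11Thm1ExistsUniqueStepTokensG.ApproxMinimiserExistsTop7MG`
with the data row `Dat …` and the (14) row `ApproxMinTopB … (bd K k s.Ω) W U₀`.  [15] (11)–(13): *«We can easily construct a configuration V₀ on 𝔅′_{k−1} such that it satisfies (7) on
𝔅′_{k−1}, and V₀ = V on ⋃_{j<k} Λ_j, V̄₀ = V on Λ_k»*, the length-`(k−1)` minimiser is in `U_k({Ω_j}, B₃L³ε₁) ∩ 𝔘_k(𝔅_k, V)`, and at `k = 1` *«we take simply U₀ = V₀»*.  At print's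
datum `bd := lamDatum F` ([II] (2.3): no inward connectors) the agreement half is print's «U_j = V on Λ_j» verbatim — the interface-solvability artefact of the `bondsOf`-MEETING
instance (the lane's located note (ℓ2)) is a property of the (b)-instance only.  Print-datum parametrisation of `ApproxMinimiserExistsTop7MG` (FLAG №16 ∕ LOCATE-HSEAM
5d3298b8d191f169); the (b)-instance stays landed and true on its own text (`approxMinimiserExistsTop7MG_iff_GB`).  NO producer in the tree.
-- TODO(general form): print's (11)–(13) for general admissible `{Ω_j}`; one threshold `ε₁`.
[cite: Balaban1985Variational, (11) p.279, (12)–(14) p.280; Balaban1985RegularSpaces, (1.3)–(1.9) p.77; Balaban1984PropagatorsII, (2.3) p.224; Balaban1988Convergent, (2.10)–(2.12) p.256, (2.18) p.257] -/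
def ApproxMinimiserExistsTop7MGB (Sup : (ν : Stage7Numerics) → (K : ℕ) → (ℕ → Set (Site (F.P K) 0)) → Set (Site (F.P K) 0)) (Adm : StepGuard F) (bd : BondDatum F)
    (Dat : TopData F N) (C₁ B₃ a₀ a₁ : ℝ) : Prop :=
  ∀ (ν : Stage7Numerics) (M : ℕ) (g : ℕ → ℝ) (K k : ℕ) (s : SeqOfRecord F ν M g K k), 0 < k → Sect2.SeqSeparated ν.M₁ s → 0 < ν.M₁ → Adm ν M g K k s → ∀ (ε₀ : ℝ) (δ : ℕ → ℝ),
    (∀ n, n ≤ k → 0 < δ n ∧ δ n ≤ a₁ ∧ B₃ * δ n ≤ ε₀) → (∀ n, n < k → δ n ≤ 2 * δ (n + 1)) → (∀ n, n < k → δ (n + 1) ≤ 2 * δ n) → ε₀ ≤ a₀ →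
    ∀ W : MSField (F.P K) (SU N), Dat K s.Ω (Sup ν K s.Ω) k δ W →
      ∃ U₀ : GaugeField (F.P K) 0 (SU N), ApproxMinTopB (avOfRecord F N K) s.Ω (Sup ν K s.Ω) k (fun n => C₁ * B₃ * δ n) (bd K k s.Ω) W U₀

/-- **NAMED TOKEN, `CoP` EDITION OVER `(bd, Dat)` — AN APPROXIMATE MINIMISER EXISTS, ON THE SUPPORT OF RECORD** (`approxMinimiserExistsCoP7MG_iff_GB` recovers the (b)-instance).
[cite: Balaban1985Variational, (11) p.279, (12)–(14) p.280; Balaban1984PropagatorsII, (2.3) p.224; Balaban1988Convergent, p.255, (2.12) p.256] -/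
def ApproxMinimiserExistsCoP7MGB (Adm : StepGuard F) (bd : BondDatum F) (Dat : TopData F N) (C₁ B₃ a₀ a₁ : ℝ) : Prop :=
  ApproxMinimiserExistsTop7MGB F N (fun ν K Ω => suppDomOfRecord F ν K Ω) Adm bd Dat C₁ B₃ a₀ a₁

variable {F N}

/-- ★ The lane's step token `VariationalThm1EUStepTop7MG` IS the instance `(genSetDatum F) (dataSmall7PTopOf F N)` — definitionally (`approxMinTop_iff_B`, F0a's `Iff.rfl`s).
[cite: Balaban1985Variational, Prop. 2 p.281; Balaban1988Convergent, (2.10)–(2.12) p.256; Balaban1987RG1, (0.1) p.251] -/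
theorem variationalThm1EUStepTop7MG_iff_GB {Sup : (ν : Stage7Numerics) → (K : ℕ) → (ℕ → Set (Site (F.P K) 0)) → Set (Site (F.P K) 0)} {Adm : StepGuard F} {C₁ B₃ a₀ a₁ : ℝ} :
    VariationalThm1EUStepTop7MG F N Sup Adm C₁ B₃ a₀ a₁ ↔ VariationalThm1EUStepTop7MGB F N Sup Adm (genSetDatum F) (dataSmall7PTopOf F N) C₁ B₃ a₀ a₁ := Iff.rfl

/-- ★ The lane's `CoP` step token IS the instance `(genSetDatum F) (dataSmall7PTopOf F N)`, definitionally. [cite: Balaban1985Variational, Prop. 2 p.281; Balaban1988Convergent, (2.12) p.256] -/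
theorem variationalThm1EUStepCoP7MG_iff_GB {Adm : StepGuard F} {C₁ B₃ a₀ a₁ : ℝ} :
    VariationalThm1EUStepCoP7MG F N Adm C₁ B₃ a₀ a₁ ↔ VariationalThm1EUStepCoP7MGB F N Adm (genSetDatum F) (dataSmall7PTopOf F N) C₁ B₃ a₀ a₁ := Iff.rfl

/-- The lane's supply token `ApproxMinimiserExistsTop7MG` IS the instance `(genSetDatum F) (dataSmall7PTopOf F N)`, definitionally. [cite: Balaban1985Variational, (14) p.280; Balaban1988Convergent, (2.10)–(2.12) p.256; Balaban1987RG1, (0.1) p.251] -/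
theorem approxMinimiserExistsTop7MG_iff_GB {Sup : (ν : Stage7Numerics) → (K : ℕ) → (ℕ → Set (Site (F.P K) 0)) → Set (Site (F.P K) 0)} {Adm : StepGuard F} {C₁ B₃ a₀ a₁ : ℝ} :
    ApproxMinimiserExistsTop7MG F N Sup Adm C₁ B₃ a₀ a₁ ↔ ApproxMinimiserExistsTop7MGB F N Sup Adm (genSetDatum F) (dataSmall7PTopOf F N) C₁ B₃ a₀ a₁ := Iff.rfl

/-- The lane's `CoP` supply token IS the instance `(genSetDatum F) (dataSmall7PTopOf F N)`, definitionally. [cite: Balaban1985Variational, (14) p.280; Balaban1988Convergent, (2.12) p.256] -/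
theorem approxMinimiserExistsCoP7MG_iff_GB {Adm : StepGuard F} {C₁ B₃ a₀ a₁ : ℝ} :
    ApproxMinimiserExistsCoP7MG F N Adm C₁ B₃ a₀ a₁ ↔ ApproxMinimiserExistsCoP7MGB F N Adm (genSetDatum F) (dataSmall7PTopOf F N) C₁ B₃ a₀ a₁ := Iff.rfl

/-- The `CoP` step token over `(bd, Dat)` IS the top-domain token at node00-def-R's selector (definitional). [cite: Balaban1985Variational, Prop. 2 p.281 (bookkeeping)] -/
theorem variationalThm1EUStepCoP7MGB_iff {Adm : StepGuard F} {bd : BondDatum F} {Dat : TopData F N} {C₁ B₃ a₀ a₁ : ℝ} :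
    VariationalThm1EUStepCoP7MGB F N Adm bd Dat C₁ B₃ a₀ a₁ ↔ VariationalThm1EUStepTop7MGB F N (fun ν K Ω => suppDomOfRecord F ν K Ω) Adm bd Dat C₁ B₃ a₀ a₁ := Iff.rfl

/-- The `CoP` supply token over `(bd, Dat)` IS the top-domain token at node00-def-R's selector (definitional). [cite: Balaban1985Variational, (14) p.280 (bookkeeping)] -/
theorem approxMinimiserExistsCoP7MGB_iff {Adm : StepGuard F} {bd : BondDatum F} {Dat : TopData F N} {C₁ B₃ a₀ a₁ : ℝ} :
    ApproxMinimiserExistsCoP7MGB F N Adm bd Dat C₁ B₃ a₀ a₁ ↔ ApproxMinimiserExistsTop7MGB F N (fun ν K Ω => suppDomOfRecord F ν K Ω) Adm bd Dat C₁ B₃ a₀ a₁ := Iff.rfl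

end TokensGB

/-! ## §4  Print's lift (11)–(13) along the truncation, over `(bd, Dat)` -/

section LiftGB

variable (F : T4Family) (N : ℕ) [NeZero N]

/-- **★ NAMED TOKEN — PRINT'S LIFT (11)–(13) ALONG THE TRUNCATION `truncSeq s`, OVER `(bd, Dat)`** (a `Prop` with parameters, NEVER asserted):
`B11Thm1ExistsUniqueInductionG.VariationalThm1EULiftTop7MG` with the data rows `Dat K s.Ω …` ∕ `Dat K (truncSeq s).Ω …`, the truncated problem's minimiser row `IsMinimizerB …
(bd K k (truncSeq s).Ω) V₀ U` and the (14) row `ApproxMinTopB … (bd K (k+1) s.Ω) W U`; every other byte identical: at an index `s` of length `k + 1`, `0 < k`, under the name's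
binders and a datum `W` with `Dat`, THERE EXIST truncated thresholds `ε₀′ ≤ a₀`, `δ′` (in range at `(B₃, a₁)`, comparable both ways on `n ≤ k`) and a datum `V₀` with `Dat` for
`(truncSeq s, k)` — print's (11) — such that every `B₃δ′`-regular minimiser of the truncated problem at `ε₀′` with the data `V₀` on `bd K k (truncSeq s).Ω` is an approximate minimiser
(14) for `(s, W)` at `C₁B₃δ` on `bd K (k+1) s.Ω` — print's (12)–(13).  At print's datum `bd := lamDatum F` the agreement half at the new top level is print's «V̄₀ = V on Λ_k»
bookkeeping with NO interface-solvability demand (that artefact, the lane's located note (ℓ2), belongs to the (b)-instance).  Print-datum parametrisation of `VariationalThm1EULiftTop7MG`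
(FLAG №16 ∕ LOCATE-HSEAM 5d3298b8d191f169); the (b)-instance stays landed and true on its own text (`variationalThm1EULiftTop7MG_iff_GB`).  NO producer in the tree.
-- TODO(general form): print's (11)–(13) for general admissible `{Ω_j}`; one threshold `ε₁` (`C₁ = L³`; in the per-scale currency `C₁ = 2L³`, the lane's note of 2026-08-30).
[cite: Balaban1985Variational, (11) p.279, (12)–(14) p.280, (2)–(7) p.278; Balaban1985RegularSpaces, (1.3)–(1.9) p.77; Balaban1984PropagatorsII, (2.3) p.224; Balaban1988Convergent, (2.1) p.254, (2.10)–(2.12) p.256, (2.18) p.257] -/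
def VariationalThm1EULiftTop7MGB (Sup : (ν : Stage7Numerics) → (K : ℕ) → (ℕ → Set (Site (F.P K) 0)) → Set (Site (F.P K) 0)) (Adm : StepGuard F) (bd : BondDatum F)
    (Dat : TopData F N) (C₁ B₃ a₀ a₁ : ℝ) : Prop :=
  ∀ (ν : Stage7Numerics) (M : ℕ) (g : ℕ → ℝ) (K k : ℕ) (s : SeqOfRecord F ν M g K (k + 1)), 0 < k → Sect2.SeqSeparated ν.M₁ s → 0 < ν.M₁ → Adm ν M g K (k + 1) s →
    ∀ (ε₀ : ℝ) (δ : ℕ → ℝ),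
    (∀ n, n ≤ k + 1 → 0 < δ n ∧ δ n ≤ a₁ ∧ B₃ * δ n ≤ ε₀) → (∀ n, n < k + 1 → δ n ≤ 2 * δ (n + 1)) → (∀ n, n < k + 1 → δ (n + 1) ≤ 2 * δ n) → ε₀ ≤ a₀ →
    ∀ W : MSField (F.P K) (SU N), Dat K s.Ω (Sup ν K s.Ω) (k + 1) δ W →
      ∃ (ε₀' : ℝ) (δ' : ℕ → ℝ) (V₀ : MSField (F.P K) (SU N)),
        (∀ n, n ≤ k → 0 < δ' n ∧ δ' n ≤ a₁ ∧ B₃ * δ' n ≤ ε₀') ∧ (∀ n, n < k → δ' n ≤ 2 * δ' (n + 1)) ∧ (∀ n, n < k → δ' (n + 1) ≤ 2 * δ' n) ∧ ε₀' ≤ a₀ ∧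
        Dat K (truncSeq s).Ω (Sup ν K (truncSeq s).Ω) k δ' V₀ ∧
        ∀ U : GaugeField (F.P K) 0 (SU N),
          IsMinimizerB (avOfRecord F N K)
              {U | (∀ n, n ≤ k → PlaqSmallOn (Sect2.omegaPlaqsTop (truncSeq s).Ω (Sup ν K (truncSeq s).Ω) n) (ε₀' * (F.P K).eta n ^ 2) U) ∧
                Sect2.CoDivClassOnTop (truncSeq s).Ω (Sup ν K (truncSeq s).Ω) k ε₀' U} (bd K k (truncSeq s).Ω) V₀ U →
          ((∀ n, n ≤ k → PlaqSmallOn (Sect2.omegaPlaqsTop (truncSeq s).Ω (Sup ν K (truncSeq s).Ω) n) (B₃ * δ' n * (F.P K).eta n ^ 2) U) ∧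
            ∀ n, n ≤ k → Sect2.CoDivSmallOn (Sect2.omegaBondsTop (truncSeq s).Ω (Sup ν K (truncSeq s).Ω) n) (B₃ * δ' n * (F.P K).eta n ^ 3) U) →
          ApproxMinTopB (avOfRecord F N K) s.Ω (Sup ν K s.Ω) (k + 1) (fun n => C₁ * B₃ * δ n) (bd K (k + 1) s.Ω) W U

/-- **★ NAMED TOKEN, `CoP` EDITION OVER `(bd, Dat)` — PRINT'S LIFT (11)–(13) ON THE SUPPORT OF RECORD** (`variationalThm1EULiftCoP7MG_iff_GB` recovers the (b)-instance).
[cite: Balaban1985Variational, (11) p.279, (12)–(14) p.280; Balaban1984PropagatorsII, (2.3) p.224; Balaban1988Convergent, p.255, (2.12) p.256] -/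
def VariationalThm1EULiftCoP7MGB (Adm : StepGuard F) (bd : BondDatum F) (Dat : TopData F N) (C₁ B₃ a₀ a₁ : ℝ) : Prop :=
  VariationalThm1EULiftTop7MGB F N (fun ν K Ω => suppDomOfRecord F ν K Ω) Adm bd Dat C₁ B₃ a₀ a₁

variable {F N}

/-- ★ The lane's lift token `VariationalThm1EULiftTop7MG` IS the instance `(genSetDatum F) (dataSmall7PTopOf F N)` — definitionally. [cite: Balaban1985Variational, (11)–(13) pp.279–280; Balaban1988Convergent, (2.10)–(2.12) p.256; Balaban1987RG1, (0.1) p.251] -/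
theorem variationalThm1EULiftTop7MG_iff_GB {Sup : (ν : Stage7Numerics) → (K : ℕ) → (ℕ → Set (Site (F.P K) 0)) → Set (Site (F.P K) 0)} {Adm : StepGuard F} {C₁ B₃ a₀ a₁ : ℝ} :
    VariationalThm1EULiftTop7MG F N Sup Adm C₁ B₃ a₀ a₁ ↔ VariationalThm1EULiftTop7MGB F N Sup Adm (genSetDatum F) (dataSmall7PTopOf F N) C₁ B₃ a₀ a₁ := Iff.rfl

/-- ★ The lane's `CoP` lift token IS the instance `(genSetDatum F) (dataSmall7PTopOf F N)`, definitionally. [cite: Balaban1985Variational, (11)–(13) pp.279–280; Balaban1988Convergent, (2.12) p.256] -/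
theorem variationalThm1EULiftCoP7MG_iff_GB {Adm : StepGuard F} {C₁ B₃ a₀ a₁ : ℝ} :
    VariationalThm1EULiftCoP7MG F N Adm C₁ B₃ a₀ a₁ ↔ VariationalThm1EULiftCoP7MGB F N Adm (genSetDatum F) (dataSmall7PTopOf F N) C₁ B₃ a₀ a₁ := Iff.rfl

/-- The `CoP` lift token over `(bd, Dat)` IS the top-domain token at node00-def-R's selector (definitional). [cite: Balaban1985Variational, (11) p.279 (bookkeeping)] -/
theorem variationalThm1EULiftCoP7MGB_iff {Adm : StepGuard F} {bd : BondDatum F} {Dat : TopData F N} {C₁ B₃ a₀ a₁ : ℝ} :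
    VariationalThm1EULiftCoP7MGB F N Adm bd Dat C₁ B₃ a₀ a₁ ↔ VariationalThm1EULiftTop7MGB F N (fun ν K Ω => suppDomOfRecord F ν K Ω) Adm bd Dat C₁ B₃ a₀ a₁ := Iff.rfl

end LiftGB

end Literature.MathematicalPhysics.QuantumFieldTheory.Balaban1983to89.B11Thm1ExistsUniqueTokensGB

end
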